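import Summits.CriticalPhenomena.SAWScalingLimit.Theorems.SAWLeftRightFKGFKGToTraversalBoundSlitNecklaceOutline
import Literature.Probability.RandomPlanarGeometry.PlanarDomains
import Literature.Probability.LatticeModels.DomainDiscretisation
import HarnessLib

/-!
# Vocabulary of line `slit-necklace`, part 7: the BOUNDARY BUDGET (witness unit U6) as a hypothesis name

Crux `SAWLeftRightFKG.FKGToTraversalBound` (stmt-CriticalPhenomena-1878), line `slit-necklace`, lead
prover-line-stmt-CriticalPhenomena-1878-c5-0; NOTES `## Witness plan v2`, `## U6 notes`.

The planar witness `NecklaceWitnessFarU` charges the windows of its route (an outline arc of the free component `F`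
of the far tip) to three accounts: class changes (Davenport–Schinzel + `btour_abab`), lower far pieces (cyclic
monotonicity, `obstacle_*`), and the DOMAIN BOUNDARY.  The last account is the number of strictly separated windows of
the wall-follower tour of a discretised piece `B` of the domain (`F ⊆ B ⊆ D_δ`, reduced to `B` by `btour_shared_order`)
across the shell `D(y; σ₁, σ₂)` whose two end edges FACE THE BOUNDARY: the unit segment from the outline site to the
contact site meets `∂D`.  `BoundaryBudget` asserts that this number is bounded by a constant `nB(D; y, σ₁, σ₂)` for all
small meshes, uniformly in `B` — the expected proof maps each window to the sub-arc of `∂D` between the first boundary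
points ("feet") on its two end segments, shows by planarity (Schoenflies: `JordanDomain.exists_homeomorph_closedBall_closure`)
that feet occur along `∂D` in tour order, so that the `q` sub-arcs are disjoint and each traverses the thinner shell
`D(y; σ₁ + δ, σ₂ - δ)`, and bounds `q` by the finite traversal number of the Jordan curve `∂D`
(`Curve.exists_not_hasTraversals`).  It is recorded here as a HYPOTHESIS NAME of the line (a definition used as a stub
hypothesis, not a literature fact; OPEN as a formalisation task, believed true); the glue proves
`BoundaryBudget → NecklaceWitnessFarU`.

Definitions only; no literature fact; nothing restates the crux.
-/

noncomputable section

open Filter Topology Set Metric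
open Literature.Probability.LatticeModels
open Literature.Probability.RandomPlanarGeometry

namespace Summit.CriticalPhenomena.SAWScalingLimit.Theorems.FKGToTraversalBound.SlitNecklace

/-- The boundary edge `e = (x, d)` of a site set FACES THE BOUNDARY of the domain `Ω` at mesh `δ`: the closed unit
segment from the mesh point of the outline site `x` to that of the contact site `x + d` meets the frontier of `Ω`.
[folklore] -/
def FacesBoundary (Ω : Set ℂ) (δ : ℝ) (e : Site 2 × ODir) : Prop :=
  (segment ℝ (meshPoint δ (bsite e)) (meshPoint δ (bcontact e)) ∩ frontier Ω).Nonempty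

/-- **BOUNDARY BUDGET** (witness unit U6 of line `slit-necklace`).  For every Dobrushin domain `D` and genuine shell
`D(y; σ₁, σ₂)` there is `nB` such that for all small meshes `δ`: whenever `B` is a finite `4`-connected site set with
`4`-connected complement whose sites are mesh points of `D` and whose lattice-adjacent sites are joined in `D_δ`
(a discretised piece of the domain), `e` a boundary edge of `B` with injective tour period `N`, and
`[a m, b m] ⊆ [0, N)` (`m < q`) strictly separated tour windows (`b m < a m'` for `m < m'`) across the shell — the
outline site at `a m` within `σ₁` of `y` and that at `b m` at distance `≥ σ₂`, or the reverse — BOTH of whose end edges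
face the boundary of `D`, then `q ≤ nB`.  (HYPOTHESIS NAME of the line — a definition used as a stub hypothesis, not a
literature fact; OPEN as a formalisation task, believed true: feet on `∂D` in tour order by Schoenflies, then the finite
traversal number of the Jordan curve `∂D` across `D(y; σ₁ + δ, σ₂ - δ)`.) -/
def BoundaryBudget : Prop :=
  ∀ (D : DobrushinDomain) (y : ℂ) (σ₁ σ₂ : ℝ), 0 < σ₁ → σ₁ < σ₂ → ∃ nB : ℕ, ∀ᶠ δ in 𝓝[>] (0 : ℝ),
    ∀ (B : Finset (Site 2)) (e : Site 2 × ODir) (N q : ℕ) (a b : Fin q → ℕ),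
      (∀ x ∈ B, meshPoint δ x ∈ D.carrier) →
      (∀ x ∈ B, ∀ x' ∈ B, (zdGraph 2).Adj x x' → (discreteDomainGraph D.carrier δ).Adj x x') →
      (∀ x ∈ B, ∀ x' ∈ B, ∃ w : (zdGraph 2).Walk x x', ∀ z ∈ w.support, z ∈ B) →
      (∀ x x' : Site 2, x ∉ B → x' ∉ B → ∃ w : (zdGraph 2).Walk x x', ∀ z ∈ w.support, z ∉ B) →
      IsBEdge (↑B : Set (Site 2)) e → 0 < N → btour (↑B : Set (Site 2)) e N = e →
      (∀ j j', j < N → j' < N → btour (↑B : Set (Site 2)) e j = btour (↑B : Set (Site 2)) e j' → j = j') →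
      (∀ m, a m < b m ∧ b m < N) → (∀ ⦃m m' : Fin q⦄, m < m' → b m < a m') →
      (∀ m, (dist (meshPoint δ (bsite (btour (↑B : Set (Site 2)) e (a m)))) y ≤ σ₁ ∧
          σ₂ ≤ dist (meshPoint δ (bsite (btour (↑B : Set (Site 2)) e (b m)))) y) ∨
        (σ₂ ≤ dist (meshPoint δ (bsite (btour (↑B : Set (Site 2)) e (a m)))) y ∧
          dist (meshPoint δ (bsite (btour (↑B : Set (Site 2)) e (b m)))) y ≤ σ₁)) →
      (∀ m, FacesBoundary D.carrier δ (btour (↑B : Set (Site 2)) e (a m)) ∧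
        FacesBoundary D.carrier δ (btour (↑B : Set (Site 2)) e (b m))) →
      q ≤ nB

/-- A preconnected set meeting both `s` and its complement meets the frontier of `s`. [folklore] -/
private theorem preconn_inter_frontier_nonempty {c s : Set ℂ} (hc : IsPreconnected c)
    (h₁ : (c ∩ s).Nonempty) (h₂ : (c ∩ sᶜ).Nonempty) : (c ∩ frontier s).Nonempty := by
  by_contra h
  rw [not_nonempty_iff_eq_empty] at h
  have hu : IsOpen (interior s) := isOpen_interior
  have hv : IsOpen (closure s)ᶜ := isClosed_closure.isOpen_compl
  have hcov : c ⊆ interior s ∪ (closure s)ᶜ := by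
    intro x hx
    by_contra hx'
    simp only [mem_union, mem_compl_iff, not_or, not_not] at hx'
    have : x ∈ c ∩ frontier s := ⟨hx, hx'.2, hx'.1⟩
    rw [h] at this
    exact this
  obtain ⟨x, hx, hxs⟩ := h₁
  obtain ⟨x', hx', hx's⟩ := h₂
  have hxi : x ∈ interior s := by
    rcases hcov hx with h' | h'
    · exact h'
    · exact absurd (subset_closure hxs) h'
  have hx'e : x' ∈ (closure s)ᶜ := by
    rcases hcov hx' with h' | h'
    · exact absurd (interior_subset h') hx's
    · exact h'
  obtain ⟨z, -, hz1, hz2⟩ := hc _ _ hu hv hcov ⟨x, hx, hxi⟩ ⟨x', hx', hx'e⟩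
  exact hz2 (subset_closure (interior_subset hz1))

/-- **Registered glue**: a boundary edge whose contact mesh point lies outside the open domain faces the boundary
(the unit segment is connected, starts inside and ends outside, so it meets the frontier). [folklore] -/
theorem facesBoundary_of_notMem : ∀ (Ω : Set ℂ) (δ : ℝ) (e : Site 2 × ODir), meshPoint δ (bsite e) ∈ Ω → meshPoint δ (bcontact e) ∉ Ω → FacesBoundary Ω δ e := by
  intro Ω δ e hx hy
  exact preconn_inter_frontier_nonempty (convex_segment _ _).isPreconnected
    ⟨_, left_mem_segment ℝ _ _, hx⟩ ⟨_, right_mem_segment ℝ _ _, hy⟩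

end Summit.CriticalPhenomena.SAWScalingLimit.Theorems.FKGToTraversalBound.SlitNecklace

end
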